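import Summits.ResolutionOfSingularities.ResolutionOfSingularities.Theorems.FrobeniusLadderFInjectiveMacaulayficationX2Cubic4Specimen
import Summits.ResolutionOfSingularities.ResolutionOfSingularities.Theorems.FrobeniusLadderFInjectiveMacaulayficationE4GermSingularCentre
import HarnessLib

/-!
# (RR-I2) THE SINGULAR CENTRE `𝓚_Σ` ON THE POINT BLOW-UP `Y₁ = Bl_𝔪 Y` OF `Y = {x² + y³ + u³ + t³ + s³ = 0}` (`2, 3 ≠ 0` in `k`) — scheme-level half
# (T″-side second kernel instance; crux `FInjectiveMacaulayfication` stmt-ResolutionOfSingularities-15315, chain w45a; template = res-L1-w45a-lead-1 g7's `E4GermSingularCentre`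
# (E4″@G (F2) part 1); consumer = the (ROW) `tStepInstanceAt_x2cubic4_origin` via `TStepGerm.tStepInstanceAt_of_isBlowup`; seat res-L1-w45a-lead-1 g11)

[OURS · L1 W4.5a] Support file (`--supports stmt-ResolutionOfSingularities-15315 --as helper`); replaces the role of NO printed item; NOT a statement of any
manuscript; def-free; UNCONDITIONAL. AI-written (AI review is weaker than expert review).

THE OBJECTS. `Y = Spec (k[X₀..X₄]/(f))`, `f = X₄² + X₀³ + X₁³ + X₂³ + X₃³` (`2 ≠ 0`, `3 ≠ 0` in `k` — every characteristic `p ≥ 5` and `0`), `v` = the vertex, `𝔪 = (x̄₀, …, x̄₄)`,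
`Y₁ := affineBlowup 𝔪`, `π₁ := affineBlowup.π 𝔪` (floor 1 of the T″(p,4,·) instance at `(Y, v)`, res-L1-w45a-lead-1 g10 ✓ `X2Cubic4PointFloor`). The floor-2 centre is the
REDUCED SINGULAR LOCUS of `Y₁`: `𝓚_Σ := Scheme.IdealSheafData.vanishingIdeal Z` for the closed set `Z = (Reg Y₁)ᶜ` (canonical, chart-free; on the charts it is the Fermat-cubic
surface `Σ`, next files). This file proves the two scheme-level binders `TStepGerm.tStepInstanceAt_of_isBlowup` asks of the centre, for ANY `Z : Closeds Y₁` with `↑Z = (Reg Y₁)ᶜ`: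
* §1 `π_eq_vertex_of_not_mem_regularLocus` — a non-regular point of `Y₁` lies over `v` (`Y` is regular off `v`, `X2Cubic4Specimen.regular_off_vertex`, and `π₁` is an isomorphism
  over each `D(x̄ⱼ)`, Stacks 02OS); `centre_ne_bot`; `exists_over_generic` — a regular point of `Y₁` over the generic point of `Y`;
* §2 (closedness of `(Reg Y₁)ᶜ` is `E4GermSingularCentre.isClosed_compl_regularLocus`, any hypersurface — cited, not restated) `vanishingIdeal_ne_bot`, ★ `support_vanishingIdeal_over_vertex`
  (the `hsupp` binder), ★ `comap_pullback_fst_vanishingIdeal_ne_bot` (the `h𝓚` binder: `𝓚_Σ·𝒪_{Y₁ ×_Y Spec 𝒪_{Y,v}} ≠ ⊥`).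
[cite: StacksProject, Tag 02OS; Tag 01J7] [cite: Matsumura1987, §30, Cor. to Thm. 30.5] [cite: GortzWedhorn2020, Prop. 13.91 (2)]
-/

-- single-problem summit: the doubled namespace component is forced
set_option linter.dupNamespace false

noncomputable section

namespace Summit.ResolutionOfSingularities.ResolutionOfSingularities.Theorems.FInjectiveMacaulayfication.X2Cubic4SingularCentre

open CategoryTheory AlgebraicGeometry TopologicalSpace IsLocalRing MvPolynomial
open Literature.AlgebraicGeometry.Resolution
open Summit.ResolutionOfSingularities.ResolutionOfSingularities.Theorems.FInjectiveMacaulayfication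
open X2Cubic4Specimen

variable (k : Type) [Field k]

/-! ## §1 Non-regular points of `Y₁ = Bl_𝔪 Y` lie over the vertex -/

/-- ★ **A non-regular point of `Bl_𝔪 Y` lies over the vertex**: off `π₁⁻¹(v)` the blow-up is an isomorphism onto `Y ∖ {v}` (Stacks 02OS over each `D(x̄ⱼ)`),
and `Y` is regular off `v` (`2, 3 ≠ 0`). [cite: StacksProject, Tag 02OS] -/
theorem π_eq_vertex_of_not_mem_regularLocus (h2 : (2 : k) ≠ 0) (h3 : (3 : k) ≠ 0) (f : MvPolynomial (Fin 5) k)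
    (hf : f = X 4 ^ 2 + X 0 ^ 3 + X 1 ^ 3 + X 2 ^ 3 + X 3 ^ 3)
    (v : Spec (.of (MvPolynomial (Fin 5) k ⧸ Ideal.span {f})))
    (hv : v.asIdeal = Ideal.span (Set.range fun j : Fin 5 => Ideal.Quotient.mk (Ideal.span {f}) (X j)))
    (𝔪 : Ideal (MvPolynomial (Fin 5) k ⧸ Ideal.span {f})) (h𝔪 : 𝔪 = Ideal.span (Set.range fun j : Fin 5 => Ideal.Quotient.mk (Ideal.span {f}) (X j)))
    (x₁ : ↥(affineBlowup 𝔪)) (hx₁ : x₁ ∉ Scheme.regularLocus (affineBlowup 𝔪)) :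
    (affineBlowup.π 𝔪).base x₁ = v := by
  classical
  by_contra hne
  -- `𝔪 ⊄ w`: otherwise `w = v` by maximality of `𝔪`
  have hmax : 𝔪.IsMaximal := by
    rw [h𝔪]; exact DoublePointFermatCubicGerm.isMaximal_origin k f (constantCoeff_f k f hf)
  have hnotle : ¬ 𝔪 ≤ ((affineBlowup.π 𝔪).base x₁).asIdeal := by
    intro hle
    apply hne
    apply PrimeSpectrum.ext
    rw [hv, ← h𝔪]
    exact (hmax.eq_of_le ((affineBlowup.π 𝔪).base x₁).isPrime.ne_top hle).symm
  -- a generator `x̄ⱼ ∉ w`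
  obtain ⟨j, hj⟩ : ∃ j : Fin 5, Ideal.Quotient.mk (Ideal.span {f}) (X j) ∉ ((affineBlowup.π 𝔪).base x₁).asIdeal := by
    by_contra hall
    push Not at hall
    exact hnotle (h𝔪.le.trans (Ideal.span_le.mpr (by rintro _ ⟨j, rfl⟩; exact hall j)))
  have hjm : Ideal.Quotient.mk (Ideal.span {f}) (X j) ∈ 𝔪 := h𝔪 ▸ Ideal.subset_span ⟨j, rfl⟩
  haveI := affineBlowup.isIso_morphismRestrict (I := 𝔪) (Ideal.Quotient.mk (Ideal.span {f}) (X j)) hjm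
  have hwU : (affineBlowup.π 𝔪).base x₁ ∈ PrimeSpectrum.basicOpen (Ideal.Quotient.mk (Ideal.span {f}) (X j)) :=
    (PrimeSpectrum.mem_basicOpen _ _).mpr hj
  have hwreg : (affineBlowup.π 𝔪).base x₁ ∈ Scheme.regularLocus (Spec (.of (MvPolynomial (Fin 5) k ⧸ Ideal.span {f}))) :=
    FermatCubicConeGerm.mem_regularLocus_Spec_of_isRegularLocalRing _ (regular_off_vertex k h2 h3 f hf _ (h𝔪 ▸ hnotle))
  exact hx₁ ((mem_regularLocus_iff_of_isIso_morphismRestrict (affineBlowup.π 𝔪)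
    (PrimeSpectrum.basicOpen (Ideal.Quotient.mk (Ideal.span {f}) (X j))) x₁ hwU).mpr hwreg)

/-- `𝔪 ≠ ⊥` (`x̄₀ ≠ 0` in the domain `k[X]/(f)`). [folklore] -/
theorem centre_ne_bot (h3 : (3 : k) ≠ 0) (f : MvPolynomial (Fin 5) k) (hf : f = X 4 ^ 2 + X 0 ^ 3 + X 1 ^ 3 + X 2 ^ 3 + X 3 ^ 3)
    (𝔪 : Ideal (MvPolynomial (Fin 5) k ⧸ Ideal.span {f})) (h𝔪 : 𝔪 = Ideal.span (Set.range fun j : Fin 5 => Ideal.Quotient.mk (Ideal.span {f}) (X j))) :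
    𝔪 ≠ ⊥ := by
  have h0m : Ideal.Quotient.mk (Ideal.span {f}) (X 0) ∈ 𝔪 := h𝔪 ▸ Ideal.subset_span ⟨0, rfl⟩
  have h00 : Ideal.Quotient.mk (Ideal.span {f}) (X 0 : MvPolynomial (Fin 5) k) ≠ 0 := mk_X_ne_zero k h3 f hf 0
  exact fun h0 => h00 (by rw [← Ideal.mem_bot, ← h0]; exact h0m)

/-- **A point of `Bl_𝔪 Y` over the generic point of `Y`** (the blow-up is surjective, Stacks 02OS): over a generization of `v`, NOT over `v`, and a regular point of
`Bl_𝔪 Y` (§1). [cite: StacksProject, Tag 02OS] -/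
theorem exists_over_generic (h2 : (2 : k) ≠ 0) (h3 : (3 : k) ≠ 0) (f : MvPolynomial (Fin 5) k)
    (hf : f = X 4 ^ 2 + X 0 ^ 3 + X 1 ^ 3 + X 2 ^ 3 + X 3 ^ 3)
    (v : Spec (.of (MvPolynomial (Fin 5) k ⧸ Ideal.span {f})))
    (hv : v.asIdeal = Ideal.span (Set.range fun j : Fin 5 => Ideal.Quotient.mk (Ideal.span {f}) (X j)))
    (𝔪 : Ideal (MvPolynomial (Fin 5) k ⧸ Ideal.span {f})) (h𝔪 : 𝔪 = Ideal.span (Set.range fun j : Fin 5 => Ideal.Quotient.mk (Ideal.span {f}) (X j))) :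
    ∃ x₁ : ↥(affineBlowup 𝔪), (affineBlowup.π 𝔪).base x₁ ⤳ v ∧ (affineBlowup.π 𝔪).base x₁ ≠ v ∧ x₁ ∈ Scheme.regularLocus (affineBlowup 𝔪) := by
  classical
  haveI hfprime : (Ideal.span {f}).IsPrime := (Ideal.span_singleton_prime (prime_f k h3 f hf).ne_zero).mpr (prime_f k h3 f hf)
  haveI : IsDomain (MvPolynomial (Fin 5) k ⧸ Ideal.span {f}) := Ideal.Quotient.isDomain _
  have h𝔪ne : 𝔪 ≠ ⊥ := centre_ne_bot k h3 f hf 𝔪 h𝔪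
  -- the generic point `η` of `Y` and a point of the blow-up over it
  let η : Spec (.of (MvPolynomial (Fin 5) k ⧸ Ideal.span {f})) := ⟨⊥, Ideal.isPrime_bot⟩
  obtain ⟨x₁, hx₁⟩ := affineBlowup.surjective h𝔪ne η
  have hηv : η ⤳ v := (PrimeSpectrum.le_iff_specializes η v).mp bot_le
  have hηne : η ≠ v := by
    intro h
    have : (v.asIdeal : Ideal _) = ⊥ := by rw [← h]
    rw [hv, ← h𝔪] at this
    exact h𝔪ne this
  refine ⟨x₁, by rw [hx₁]; exact hηv, by rw [hx₁]; exact hηne, ?_⟩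
  by_contra hreg
  exact hηne (hx₁ ▸ π_eq_vertex_of_not_mem_regularLocus k h2 h3 f hf v hv 𝔪 h𝔪 x₁ hreg)

/-! ## §2 The singular centre `𝓚_Σ = vanishingIdeal Z`, `↑Z = (Reg Y₁)ᶜ`: closedness, `≠ ⊥`, support over the vertex, non-vanishing on the local model -/

/-- ★ **`hsupp` (strong form)**: every point of the support of `𝓚_Σ = vanishingIdeal Z` (`↑Z = (Reg Y₁)ᶜ`) lies over the vertex. [cite: StacksProject, Tag 02OS] -/
theorem support_vanishingIdeal_over_vertex (h2 : (2 : k) ≠ 0) (h3 : (3 : k) ≠ 0) (f : MvPolynomial (Fin 5) k)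
    (hf : f = X 4 ^ 2 + X 0 ^ 3 + X 1 ^ 3 + X 2 ^ 3 + X 3 ^ 3)
    (v : Spec (.of (MvPolynomial (Fin 5) k ⧸ Ideal.span {f})))
    (hv : v.asIdeal = Ideal.span (Set.range fun j : Fin 5 => Ideal.Quotient.mk (Ideal.span {f}) (X j)))
    (𝔪 : Ideal (MvPolynomial (Fin 5) k ⧸ Ideal.span {f})) (h𝔪 : 𝔪 = Ideal.span (Set.range fun j : Fin 5 => Ideal.Quotient.mk (Ideal.span {f}) (X j)))
    (Z : Closeds ↥(affineBlowup 𝔪)) (hZ : (Z : Set ↥(affineBlowup 𝔪)) = (Scheme.regularLocus (affineBlowup 𝔪))ᶜ) :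
    ∀ x₁ ∈ ((Scheme.IdealSheafData.vanishingIdeal Z).support : Set ↥(affineBlowup 𝔪)),
      (affineBlowup.π 𝔪).base x₁ ⤳ v → (affineBlowup.π 𝔪).base x₁ = v := by
  intro x₁ hx₁ _
  rw [Scheme.IdealSheafData.coe_support_vanishingIdeal, hZ] at hx₁
  exact π_eq_vertex_of_not_mem_regularLocus k h2 h3 f hf v hv 𝔪 h𝔪 x₁ hx₁

/-- **`𝓚_Σ ≠ ⊥`**: the blow-up has a regular point (over the generic point of `Y`), so `Z ≠ Y₁` and the vanishing ideal sheaf of `Z` is not the zero ideal. [folklore] -/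
theorem vanishingIdeal_ne_bot (h2 : (2 : k) ≠ 0) (h3 : (3 : k) ≠ 0) (f : MvPolynomial (Fin 5) k)
    (hf : f = X 4 ^ 2 + X 0 ^ 3 + X 1 ^ 3 + X 2 ^ 3 + X 3 ^ 3)
    (v : Spec (.of (MvPolynomial (Fin 5) k ⧸ Ideal.span {f})))
    (hv : v.asIdeal = Ideal.span (Set.range fun j : Fin 5 => Ideal.Quotient.mk (Ideal.span {f}) (X j)))
    (𝔪 : Ideal (MvPolynomial (Fin 5) k ⧸ Ideal.span {f})) (h𝔪 : 𝔪 = Ideal.span (Set.range fun j : Fin 5 => Ideal.Quotient.mk (Ideal.span {f}) (X j)))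
    (Z : Closeds ↥(affineBlowup 𝔪)) (hZ : (Z : Set ↥(affineBlowup 𝔪)) = (Scheme.regularLocus (affineBlowup 𝔪))ᶜ) :
    Scheme.IdealSheafData.vanishingIdeal Z ≠ ⊥ := by
  intro h0
  obtain ⟨x₁, -, -, hreg⟩ := exists_over_generic k h2 h3 f hf v hv 𝔪 h𝔪
  have hsupp := Scheme.IdealSheafData.coe_support_vanishingIdeal Z
  rw [h0, Scheme.IdealSheafData.support_bot, hZ] at hsupp
  have : x₁ ∈ (Scheme.regularLocus (affineBlowup 𝔪))ᶜ := by rw [← hsupp]; simp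
  exact this hreg

/-- ★ **`h𝓚`**: the singular centre does not vanish on the local model `Y₁ ×_Y Spec 𝒪_{Y,v}`: `𝓚_Σ.comap (pullback.fst π₁ (Y.fromSpecStalk v)) ≠ ⊥`. If it vanished, its
support — the preimage of `Z` — would be the whole local model, whose image in `Y₁` is the set of points over generizations of `v` (Stacks 01J7) and contains a point over
the generic point of `Y`, which is regular (§1). [cite: GortzWedhorn2020, Prop. 13.91 (2)] [cite: StacksProject, Tag 01J7] -/
theorem comap_pullback_fst_vanishingIdeal_ne_bot (h2 : (2 : k) ≠ 0) (h3 : (3 : k) ≠ 0) (f : MvPolynomial (Fin 5) k)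
    (hf : f = X 4 ^ 2 + X 0 ^ 3 + X 1 ^ 3 + X 2 ^ 3 + X 3 ^ 3)
    (v : Spec (.of (MvPolynomial (Fin 5) k ⧸ Ideal.span {f})))
    (hv : v.asIdeal = Ideal.span (Set.range fun j : Fin 5 => Ideal.Quotient.mk (Ideal.span {f}) (X j)))
    (𝔪 : Ideal (MvPolynomial (Fin 5) k ⧸ Ideal.span {f})) (h𝔪 : 𝔪 = Ideal.span (Set.range fun j : Fin 5 => Ideal.Quotient.mk (Ideal.span {f}) (X j)))
    (Z : Closeds ↥(affineBlowup 𝔪)) (hZ : (Z : Set ↥(affineBlowup 𝔪)) = (Scheme.regularLocus (affineBlowup 𝔪))ᶜ) :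
    (Scheme.IdealSheafData.vanishingIdeal Z).comap
      (Limits.pullback.fst (affineBlowup.π 𝔪) ((Spec (.of (MvPolynomial (Fin 5) k ⧸ Ideal.span {f}))).fromSpecStalk v)) ≠ ⊥ := by
  intro h0
  obtain ⟨x₁, hgen, hne, hreg⟩ := exists_over_generic k h2 h3 f hf v hv 𝔪 h𝔪
  -- `x₁` lies in the image of the local model
  have hmem : x₁ ∈ Set.range (Limits.pullback.fst (affineBlowup.π 𝔪) ((Spec (.of (MvPolynomial (Fin 5) k ⧸ Ideal.span {f}))).fromSpecStalk v)) := by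
    rw [range_pullback_fst_fromSpecStalk]; exact hgen
  obtain ⟨t, rfl⟩ := hmem
  -- the pulled-back centre vanishes, so its support is everything; and its support is the preimage of `Z`
  have ht : t ∈ ((((Scheme.IdealSheafData.vanishingIdeal Z).comap
      (Limits.pullback.fst (affineBlowup.π 𝔪) ((Spec (.of (MvPolynomial (Fin 5) k ⧸ Ideal.span {f}))).fromSpecStalk v))).support : Set _)) := by
    rw [h0, Scheme.IdealSheafData.support_bot]; simp
  rw [Scheme.IdealSheafData.support_comap] at ht
  have ht' : (Limits.pullback.fst (affineBlowup.π 𝔪) ((Spec (.of (MvPolynomial (Fin 5) k ⧸ Ideal.span {f}))).fromSpecStalk v)).base t ∈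
      ((Scheme.IdealSheafData.vanishingIdeal Z).support : Set _) := ht
  rw [Scheme.IdealSheafData.coe_support_vanishingIdeal, hZ] at ht'
  exact ht' hreg

end Summit.ResolutionOfSingularities.ResolutionOfSingularities.Theorems.FInjectiveMacaulayfication.X2Cubic4SingularCentre

end
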